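import Literature.MathematicalPhysics.QuantumLattice.HubbardNNNHoppingFlux
import Literature.MathematicalPhysics.QuantumLattice.HubbardNNNHoppingParticleHole
import Literature.MathematicalPhysics.QuantumLattice.SectorGroundStateParticleHolePair
import Literature.MathematicalPhysics.QuantumLattice.MagneticHubbardTorusUniformDensity
import Literature.MathematicalPhysics.QuantumLattice.HubbardTorusRepulsionGap
import HarnessLib

/-!
# Particle–hole symmetry of the FLUX-THREADED `t–t'` Hubbard torus: `(t', N, θ) ↦ (-t', 2L² - N, -θ)`;
# the flux envelope (superfluid-weight curvature) at hole doping `δ` and hopping `t'` IS the one at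
# electron doping `δ` and hopping `-t'`

Topic `Literature/MathematicalPhysics/QuantumLattice` (family `hubbard`); companion of
`HubbardNNNHoppingFlux.lean` (`hubbardTorusTT'Flux L t' U θ = hubbardTorusTT' L 1 t' U + (seamTwist L θ +
t' • diagSeamTwist L θ)`, its flux envelope `fluxEnergyTT' L t' U δ θ` = lowest energy in the sector
`(2⌊(1-δ)L²/2⌋, S^z = 0)`, and `E(-θ) = E(θ)`), of `HubbardNNNHoppingParticleHole.lean` (Lieb's staggered
particle–hole unitary `P` on the even torus: `P H_L(t,t',U) Pᴴ = H_L(t,-t',U) - U N + U L²`) and of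
`SectorGroundStateParticleHolePair.lean` (joint-sector energies under such a pair). Cell `hubbard-obs`
(D-0042), seat p2 (stiffness), `prover-hubbard-obs-p2-g16-0`: the finite-volume symmetry behind the
ELECTRON-DOPED TWINS of the certified stiffness ceilings. PROVED here (elementary Jordan–Wigner matrix
algebra; no definition, no named fact, no `sorry`), for `L` even:

* `particleHole_seamTwist` — `P · seamTwist L θ · Pᴴ = seamTwist L (-θ)`: a seam bond joins the two
  sublattices, so `P c†_{x+e₁,σ} c_{xσ} Pᴴ = c†_{xσ} c_{x+e₁,σ}` (the tree's `particleHole_mul_bond_mul_conjTranspose`)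
  — the Peierls coefficients `1 - e^{iθ}`, `1 - e^{-iθ}` are exchanged, i.e. `θ ↦ -θ`;
* `particleHole_diagSeamTwist` — `P · diagSeamTwist L θ · Pᴴ = -diagSeamTwist L (-θ)`: a diagonal bond stays
  inside a sublattice, so the hopping monomial is transposed AND changes sign;
* `particleHole_hubbardTorusTT'Flux` — **`P H^θ_L(t',U) Pᴴ = H^{-θ}_L(-t',U) - U N + U L²`**;
* `minEnergyOn_szSector_hubbardTorusTT'Flux_particleHole` — the joint-sector flux energies satisfy
  **`E^θ_{t',U}(2L² - N, S^z = 0) = E^θ_{-t',U}(N, S^z = 0) + U(L² - N)`** (`N` even, `N ≤ 2L²`; the sign of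
  `θ` is restored by `E(-θ) = E(θ)`, `minEnergyOn_hubbardTorusTT'Flux_neg`);
* `fluxEnergyTT'_particleHole` / `fluxEnergyTT'_sub_fluxEnergyTT'_zero_particleHole` — for COMPLEMENTARY
  record sectors (`2⌊(1-δ)L²/2⌋ + 2⌊(1-δ')L²/2⌋ = 2L²`, e.g. `δ' = -δ` when `(1-δ)L²/2 ∈ ℤ`):
  `E_L(t',U,δ;θ) = E_L(-t',U,δ';θ) + U(L² - 2⌊(1-δ')L²/2⌋)` and hence
  **`E_L(t',U,δ;θ) - E_L(t',U,δ;0) = E_L(-t',U,δ';θ) - E_L(-t',U,δ';0)`**: the flux curvature — the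
  quantity whose `θ → 0` stiffness is the superfluid weight of Scalapino–White–Zhang §II / the helicity
  modulus — is the SAME at `(t', n)` and `(-t', 2 - n)` on every even torus whose record sectors are
  complementary; at `t' = 0` (`fluxEnergy`) hole and electron doping have identical flux response.

HONEST LIMITS: even tori (odd tori are not bipartite); the two record sectors must be complementary
(`n L²/2 ∈ ℤ`: at `n = 7/8 ↔ 9/8` the sides `4 ∣ L`, at `n = 1` every even side); no number is produced.

References: E. H. Lieb, F. Y. Wu, Physica A 321 (2003) 1, §1 eq. (3) (`E(M,M') = -(N_a - N)U + E(N_a - M,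
N_a - M')`) [LiebWuPhysicaA2003]; F. H. L. Essler et al., *The One-Dimensional Hubbard Model* (2005) §2.2.4
eqs. (2.59)–(2.61) (Shiba transformation; same-sublattice hoppings pick up a sign) [EsslerEtAl2005];
E. H. Lieb, PRL 62 (1989) 1201, proof of Thm 2 [LiebPRL1989]; D. J. Scalapino, S. R. White, S.-C. Zhang,
PRB 47 (1993) 7995, §II (flux / twisted boundary conditions and `D_s`) [ScalapinoWhiteZhang1993];
H. Watanabe, J. Stat. Phys. 177 (2019) 717, §2.2.3, §4.1 (every seam-crossing term carries the phase)
[Watanabe2019]; N. Byers, C. N. Yang, PRL 7 (1961) 46 [ByersYang1961].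

## Mathlib / tree search
REUSED: `particleHole_hubbardTorusTT'`, `torusStagger_eq_of_diagAdj` (`HubbardNNNHoppingParticleHole`);
`particleHole_mul_bond_mul_conjTranspose`, `torusStagger_ofTorusSite_shift` (`MagneticHubbardTorusUniformDensity`);
`particleHole_mul_creation_mul_annihilation_mul_conjTranspose` (`HubbardUniformDensityGibbs`);
`minEnergyOn_szSector_particleHole_of_conj` (`SectorGroundStateParticleHolePair`); `seamTwist_eq_sum_site`
(`HubbardTorusFluxGauge`); `hubbardTorusTT'Flux_eq`, `diagSeamTwist`, `minEnergyOn_hubbardTorusTT'Flux_neg`,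
`fluxEnergyTT'_eq` (`HubbardNNNHoppingFlux`); `exists_unit_mem_szSector_two_mul` (`HubbardTorusRepulsionGap`).
`lean search 'seamTwist.*particleHole|particleHole.*Flux|fluxEnergy.*particleHole'`: nothing before this file —
the tree's particle–hole dictionaries (`TorusGroundStateParticleHole`, `TorusLimitParticleHole*`,
`StiffnessHalfBathtubParticleHole` «the exact many-body statement … is NOT claimed here») stop at zero flux.
-/

noncomputable section

namespace Literature.MathematicalPhysics.QuantumLattice

open Matrix Finset HubbardWave0 Literature.MathematicalPhysics.QuantumFieldTheory
open scoped ComplexConjugate ComplexOrder BigOperators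

section Helpers

/-- `|(ℤ/Lℤ)²| = L²`. [folklore] -/
private theorem card_fermionTorus_sq (L : ℕ) : Fintype.card (FermionTorus 2 L) = L ^ 2 := by
  simp [FermionTorus, Fintype.card_lex]

/-- The particle–hole phases of the torus are unimodular. [folklore] -/
private theorem norm_torusPhase' {L : ℕ} (i : Orb (FermionTorus 2 L)) :
    ‖((torusStagger (ofLex i).1 : ℤ) : ℂ)‖ = 1 :=
  norm_intCast_units _

/-- `(ε : ℂ)·(ε : ℂ) = 1` for a sign `ε : ℤˣ`. [folklore] -/
private theorem intCast_units_mul_self' (u : ℤˣ) : (((u : ℤ) : ℂ)) * (((u : ℤ) : ℂ)) = 1 := by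
  rcases Int.units_eq_one_or u with h | h <;> simp [h]

/-- An even nonzero natural number is at least `2`. [folklore] -/
private theorem two_le_of_even' {L : ℕ} [NeZero L] (hL : Even L) : 2 ≤ L := by
  obtain ⟨k, hk⟩ := hL
  have h0 : L ≠ 0 := NeZero.ne L
  omega

/-- `e^{-iθ} = conj e^{iθ}` on the unit circle (coerced to `ℂ`). [folklore] -/
private theorem coe_circleExp_neg (θ : ℝ) :
    (((Circle.exp (-θ) : Circle)) : ℂ) = conj (((Circle.exp θ : Circle)) : ℂ) := by
  rw [Circle.exp_neg, Circle.coe_inv_eq_conj]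

end Helpers

section FluxParticleHole

variable {L : ℕ} [NeZero L]

/-! ### §1 The seam twists under the staggered particle–hole unitary -/

/-- **`P · seamTwist L θ · Pᴴ = seamTwist L (-θ)`** (`L` even): the seam bond `x → x + e₁` joins the two
sublattices, `P c†_{x+e₁,σ} c_{xσ} Pᴴ = c†_{xσ} c_{x+e₁,σ}`, so the Peierls coefficients `1 - e^{iθ}` and
`1 - e^{-iθ}` trade places. [cite: EsslerEtAl2005, §2.2.4 eqs. (2.59)–(2.61)] [cite: Watanabe2019, §2.2.3 and §4.1] -/
theorem particleHole_seamTwist (hL : Even L) (θ : ℝ) :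
    particleHole (fun j : Orb (FermionTorus 2 L) => ((torusStagger (ofLex j).1 : ℤ) : ℂ)) *
        seamTwist L θ *
        (particleHole (fun j : Orb (FermionTorus 2 L) => ((torusStagger (ofLex j).1 : ℤ) : ℂ)))ᴴ =
      seamTwist L (-θ) := by
  rw [seamTwist_eq_sum_site, seamTwist_eq_sum_site]
  simp only [Finset.mul_sum, Finset.sum_mul]
  refine Finset.sum_congr rfl fun x _ => Finset.sum_congr rfl fun σ _ => ?_
  split_ifs with hx
  · obtain ⟨h1, h2⟩ := particleHole_mul_bond_mul_conjTranspose hL x 0 σ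
    rw [Matrix.mul_add, Matrix.add_mul, Matrix.mul_smul, Matrix.smul_mul, Matrix.mul_smul, Matrix.smul_mul,
      h2, h1, coe_circleExp_neg, starRingEnd_self_apply, add_comm]
  · rw [Matrix.mul_zero, Matrix.zero_mul]

/-- On the even torus a site and its diagonal neighbour `x + j_s` (`j_0 = e₁ + e₂`, `j_1 = e₁ - e₂`) carry the
SAME staggering sign. [cite: EsslerEtAl2005, §2.2.4, bipartite sublattices after eq. (2.60)] -/
theorem torusStagger_ofTorusSite_add_torusDiagJump (hL : Even L) (x : Site 2 L) (s : Fin 2) :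
    torusStagger (FermionTorus.ofTorusSite (L := L) (x + torusDiagJump L s)) =
      torusStagger (FermionTorus.ofTorusSite (L := L) x) := by
  have hL2 : 2 ≤ L := two_le_of_even' hL
  haveI : Fact (1 < L) := ⟨by omega⟩
  have hne : x ≠ x + torusDiagJump L s := by
    intro h
    have h0 := congrFun h 0
    simp only [Pi.add_apply, torusDiagJump, if_true] at h0
    exact one_ne_zero (add_left_cancel (h0.symm.trans (add_zero (x 0)).symm))
  have hadj : (fermionTorusDiagGraph L).Adj (FermionTorus.ofTorusSite (L := L) x)
      (FermionTorus.ofTorusSite (L := L) (x + torusDiagJump L s)) := by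
    show (torusDiagGraph L).Adj (FermionTorus.toTorusSite (FermionTorus.ofTorusSite (L := L) x))
      (FermionTorus.toTorusSite (FermionTorus.ofTorusSite (L := L) (x + torusDiagJump L s)))
    rw [FermionTorus.toTorusSite_ofTorusSite, FermionTorus.toTorusSite_ofTorusSite, torusDiagGraph,
      SimpleGraph.fromRel_adj]
    exact ⟨hne, Or.inl ⟨s, rfl⟩⟩
  exact (torusStagger_eq_of_diagAdj hL hadj).symm

/-- **The particle–hole conjugate of a DIAGONAL Peierls bond**: `P (c†_{x+j_s,σ} c_{xσ}) Pᴴ = -c†_{xσ} c_{x+j_s,σ}`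
and `P (c†_{xσ} c_{x+j_s,σ}) Pᴴ = -c†_{x+j_s,σ} c_{xσ}` (`ε_x ε_{x+j_s} = +1`, CAR).
[cite: EsslerEtAl2005, §2.2.4, remark after eq. (2.60)] -/
theorem particleHole_mul_diagBond_mul_conjTranspose (hL : Even L) (x : Site 2 L) (s σ : Fin 2) :
    particleHole (fun j : Orb (FermionTorus 2 L) => ((torusStagger (ofLex j).1 : ℤ) : ℂ)) *
        (creation (orb (FermionTorus.ofTorusSite (x + torusDiagJump L s)) σ) *
          annihilation (orb (FermionTorus.ofTorusSite x) σ)) *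
        (particleHole (fun j : Orb (FermionTorus 2 L) => ((torusStagger (ofLex j).1 : ℤ) : ℂ)))ᴴ =
      -(creation (orb (FermionTorus.ofTorusSite x) σ) *
        annihilation (orb (FermionTorus.ofTorusSite (x + torusDiagJump L s)) σ)) ∧
    particleHole (fun j : Orb (FermionTorus 2 L) => ((torusStagger (ofLex j).1 : ℤ) : ℂ)) *
        (creation (orb (FermionTorus.ofTorusSite x) σ) *
          annihilation (orb (FermionTorus.ofTorusSite (x + torusDiagJump L s)) σ)) *
        (particleHole (fun j : Orb (FermionTorus 2 L) => ((torusStagger (ofLex j).1 : ℤ) : ℂ)))ᴴ =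
      -(creation (orb (FermionTorus.ofTorusSite (x + torusDiagJump L s)) σ) *
        annihilation (orb (FermionTorus.ofTorusSite x) σ)) := by
  have hε := torusStagger_ofTorusSite_add_torusDiagJump hL x s
  have hL2 : 2 ≤ L := two_le_of_even' hL
  haveI : Fact (1 < L) := ⟨by omega⟩
  have hne : FermionTorus.ofTorusSite (L := L) x ≠ FermionTorus.ofTorusSite (x + torusDiagJump L s) := by
    intro h
    have h' := congrArg FermionTorus.toTorusSite h
    rw [FermionTorus.toTorusSite_ofTorusSite, FermionTorus.toTorusSite_ofTorusSite] at h'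
    have h0 := congrFun h' 0
    simp only [Pi.add_apply, torusDiagJump, if_true] at h0
    exact one_ne_zero (add_left_cancel (h0.symm.trans (add_zero (x 0)).symm))
  have hne1 : orb (FermionTorus.ofTorusSite (x + torusDiagJump L s)) σ ≠
      orb (FermionTorus.ofTorusSite (L := L) x) σ := fun h => hne (orb_inj.1 h).1.symm
  have hne2 : orb (FermionTorus.ofTorusSite (L := L) x) σ ≠
      orb (FermionTorus.ofTorusSite (x + torusDiagJump L s)) σ := fun h => hne (orb_inj.1 h).1
  have hprod : ((torusStagger (FermionTorus.ofTorusSite (x + torusDiagJump L s)) : ℤ) : ℂ) *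
      ((torusStagger (FermionTorus.ofTorusSite (L := L) x) : ℤ) : ℂ) = 1 := by
    rw [hε]; exact intCast_units_mul_self' _
  have hprod' : ((torusStagger (FermionTorus.ofTorusSite (L := L) x) : ℤ) : ℂ) *
      ((torusStagger (FermionTorus.ofTorusSite (x + torusDiagJump L s)) : ℤ) : ℂ) = 1 := by
    rw [hε]; exact intCast_units_mul_self' _
  constructor
  · rw [particleHole_mul_creation_mul_annihilation_mul_conjTranspose
      (fun j : Orb (FermionTorus 2 L) => torusStagger (ofLex j).1)
      (orb (FermionTorus.ofTorusSite (x + torusDiagJump L s)) σ) (orb (FermionTorus.ofTorusSite x) σ),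
      if_neg hne1,
      show ((torusStagger (ofLex (orb (FermionTorus.ofTorusSite (x + torusDiagJump L s)) σ)).1 : ℤ) : ℂ) *
          ((torusStagger (ofLex (orb (FermionTorus.ofTorusSite (L := L) x) σ)).1 : ℤ) : ℂ) = 1 from hprod,
      one_smul, zero_sub]
  · rw [particleHole_mul_creation_mul_annihilation_mul_conjTranspose
      (fun j : Orb (FermionTorus 2 L) => torusStagger (ofLex j).1)
      (orb (FermionTorus.ofTorusSite x) σ) (orb (FermionTorus.ofTorusSite (x + torusDiagJump L s)) σ),
      if_neg hne2,
      show ((torusStagger (ofLex (orb (FermionTorus.ofTorusSite (L := L) x) σ)).1 : ℤ) : ℂ) *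
          ((torusStagger (ofLex (orb (FermionTorus.ofTorusSite (x + torusDiagJump L s)) σ)).1 : ℤ) : ℂ) = 1
        from hprod', one_smul, zero_sub]

/-- **`P · diagSeamTwist L θ · Pᴴ = -diagSeamTwist L (-θ)`** (`L` even): the diagonal seam bonds stay inside a
sublattice — the monomials are transposed (`θ ↦ -θ`) and change sign (`t' ↦ -t'`).
[cite: EsslerEtAl2005, §2.2.4, remark after eq. (2.60)] [cite: Watanabe2019, §2.2.3 and §4.1] -/
theorem particleHole_diagSeamTwist (hL : Even L) (θ : ℝ) :
    particleHole (fun j : Orb (FermionTorus 2 L) => ((torusStagger (ofLex j).1 : ℤ) : ℂ)) *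
        diagSeamTwist L θ *
        (particleHole (fun j : Orb (FermionTorus 2 L) => ((torusStagger (ofLex j).1 : ℤ) : ℂ)))ᴴ =
      -diagSeamTwist L (-θ) := by
  unfold diagSeamTwist
  simp only [Finset.mul_sum, Finset.sum_mul, ← Finset.sum_neg_distrib]
  refine Finset.sum_congr rfl fun s _ => Finset.sum_congr rfl fun x _ => Finset.sum_congr rfl fun σ _ => ?_
  split_ifs with hx
  · obtain ⟨h1, h2⟩ := particleHole_mul_diagBond_mul_conjTranspose hL x s σ
    rw [Matrix.mul_add, Matrix.add_mul, Matrix.mul_smul, Matrix.smul_mul, Matrix.mul_smul, Matrix.smul_mul,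
      h1, h2, coe_circleExp_neg, starRingEnd_self_apply, smul_neg, smul_neg, add_comm, neg_add]
  · rw [Matrix.mul_zero, Matrix.zero_mul, neg_zero]

/-! ### §2 The flux-threaded `t–t'` torus under `P`: `(t', θ) ↦ (-t', -θ)`, `N ↦ 2L² - N` -/

/-- **`P H^θ_L(t', U) Pᴴ = H^{-θ}_L(-t', U) - U N + U L²`** on the even torus: the zero-flux part is Lieb–Wu /
Essler (`particleHole_hubbardTorusTT'`), the seam twists follow §1. [cite: LiebWuPhysicaA2003, §1 eq. (3)]
[cite: EsslerEtAl2005, §2.2.4 eqs. (2.59)–(2.61)] -/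
theorem particleHole_hubbardTorusTT'Flux (hL : Even L) (t' U θ : ℝ) :
    particleHole (fun j : Orb (FermionTorus 2 L) => ((torusStagger (ofLex j).1 : ℤ) : ℂ)) *
        hubbardTorusTT'Flux L t' U θ *
        (particleHole (fun j : Orb (FermionTorus 2 L) => ((torusStagger (ofLex j).1 : ℤ) : ℂ)))ᴴ =
      hubbardTorusTT'Flux L (-t') U (-θ) - (U : ℂ) • totalNumber +
        ((U * L ^ 2 : ℝ) : ℂ) •
          (1 : Matrix (Finset (Orb (FermionTorus 2 L))) (Finset (Orb (FermionTorus 2 L))) ℂ) := by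
  have h0 := particleHole_hubbardTorusTT' hL 1 t' U
  have h1 := particleHole_seamTwist hL θ
  have h2 := particleHole_diagSeamTwist hL θ
  rw [hubbardTorusTT'Flux_eq, hubbardTorusTT'Flux_eq, Matrix.mul_add, Matrix.add_mul, Matrix.mul_add,
    Matrix.add_mul, Matrix.mul_smul, Matrix.smul_mul, h1, h2]
  have h0' : particleHole (fun j : Orb (FermionTorus 2 L) => ((torusStagger (ofLex j).1 : ℤ) : ℂ)) *
        hubbardTorusTT' L 1 t' U *
        (particleHole (fun j : Orb (FermionTorus 2 L) => ((torusStagger (ofLex j).1 : ℤ) : ℂ)))ᴴ =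
      hubbardTorusTT' L 1 (-t') U - (U : ℂ) • totalNumber +
        ((U * L ^ 2 : ℝ) : ℂ) •
          (1 : Matrix (Finset (Orb (FermionTorus 2 L))) (Finset (Orb (FermionTorus 2 L))) ℂ) := by
    convert h0 using 2
  rw [h0', Complex.ofReal_neg, smul_neg, neg_smul]
  abel

/-- **Joint-sector flux energies under the particle–hole map** (`L` even, `N = 2m ≤ 2L²`):
`E^θ_{t',U}(2L² - N, S^z = 0) = E^θ_{-t',U}(N, S^z = 0) + U (L² - N)` (`minEnergyOn` of `szSector`; the
variational sets are matched by `Pᴴ`, and `E(-θ) = E(θ)`). [cite: LiebWuPhysicaA2003, §1 eq. (3)]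
[cite: ScalapinoWhiteZhang1993, §II] -/
theorem minEnergyOn_szSector_hubbardTorusTT'Flux_particleHole (hL : Even L) (t' U θ : ℝ) {m : ℕ}
    (hm : m ≤ L ^ 2) :
    (hubbardTorusTT'Flux L t' U θ).minEnergyOn (szSector (2 * L ^ 2 - 2 * m) 0) =
      (hubbardTorusTT'Flux L (-t') U θ).minEnergyOn (szSector (2 * m) 0) + U * (L ^ 2 - 2 * m) := by
  have hcard := card_fermionTorus_sq L
  have hne : ∃ φ ∈ szSector (Λ := FermionTorus 2 L) (2 * m) 0, star φ ⬝ᵥ φ = 1 :=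
    exists_unit_mem_szSector_two_mul hm
  have h := minEnergyOn_szSector_particleHole_of_conj
    (fun j : Orb (FermionTorus 2 L) => ((torusStagger (ofLex j).1 : ℤ) : ℂ)) norm_torusPhase'
    (H := hubbardTorusTT'Flux L t' U θ) (H' := hubbardTorusTT'Flux L (-t') U (-θ)) (U := U) (c := U * L ^ 2)
    (by convert particleHole_hubbardTorusTT'Flux hL t' U θ) (N := 2 * m) (by rw [hcard]; omega) 0
    (by convert hne)
  rw [hcard, neg_zero, minEnergyOn_hubbardTorusTT'Flux_neg] at h
  convert h using 1
  push_cast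
  ring

/-- **Particle–hole symmetry of the `t–t'` flux envelope.** If the record sectors of `δ` and `δ'` are
COMPLEMENTARY on the torus of even side `L` (`2⌊(1-δ)L²/2⌋ + 2⌊(1-δ')L²/2⌋ = 2L²`), then
`E_L(t',U,δ;θ) = E_L(-t',U,δ';θ) + U (L² - 2⌊(1-δ')L²/2⌋)`. [cite: LiebWuPhysicaA2003, §1 eq. (3)]
[cite: ScalapinoWhiteZhang1993, §II] -/
theorem fluxEnergyTT'_particleHole (hL : Even L) (t' U θ : ℝ) {δ δ' : ℝ}
    (hcomp : 2 * ⌊(1 - δ) * (L : ℝ) ^ 2 / 2⌋₊ + 2 * ⌊(1 - δ') * (L : ℝ) ^ 2 / 2⌋₊ = 2 * L ^ 2) :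
    fluxEnergyTT' L t' U δ θ =
      fluxEnergyTT' L (-t') U δ' θ + U * (L ^ 2 - 2 * ⌊(1 - δ') * (L : ℝ) ^ 2 / 2⌋₊) := by
  have hm : ⌊(1 - δ') * (L : ℝ) ^ 2 / 2⌋₊ ≤ L ^ 2 := by omega
  have hN : 2 * ⌊(1 - δ) * (L : ℝ) ^ 2 / 2⌋₊ = 2 * L ^ 2 - 2 * ⌊(1 - δ') * (L : ℝ) ^ 2 / 2⌋₊ := by omega
  rw [fluxEnergyTT'_eq, fluxEnergyTT'_eq, hN, minEnergyOn_szSector_hubbardTorusTT'Flux_particleHole hL t' U θ hm]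

/-- **The flux CURVATURE is particle–hole symmetric**: for complementary record sectors on an even torus,
`E_L(t',U,δ;θ) - E_L(t',U,δ;0) = E_L(-t',U,δ';θ) - E_L(-t',U,δ';0)` — the finite-volume identity behind «the
superfluid weight at hole doping `δ`, hopping `t'` equals the one at electron doping `δ`, hopping `-t'`».
[cite: ScalapinoWhiteZhang1993, §II] [cite: LiebWuPhysicaA2003, §1 eq. (3)] -/
theorem fluxEnergyTT'_sub_fluxEnergyTT'_zero_particleHole (hL : Even L) (t' U θ : ℝ) {δ δ' : ℝ}
    (hcomp : 2 * ⌊(1 - δ) * (L : ℝ) ^ 2 / 2⌋₊ + 2 * ⌊(1 - δ') * (L : ℝ) ^ 2 / 2⌋₊ = 2 * L ^ 2) :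
    fluxEnergyTT' L t' U δ θ - fluxEnergyTT' L t' U δ 0 =
      fluxEnergyTT' L (-t') U δ' θ - fluxEnergyTT' L (-t') U δ' 0 := by
  rw [fluxEnergyTT'_particleHole hL t' U θ hcomp, fluxEnergyTT'_particleHole hL t' U 0 hcomp]
  ring

/-- The `t' = 0` case (the tree's `fluxEnergy`): hole and electron doping have IDENTICAL flux curvature on
every even torus with complementary record sectors. [cite: LiebWuPhysicaA2003, §1 eq. (3)] [cite: ScalapinoWhiteZhang1993, §II] -/
theorem fluxEnergy_sub_fluxEnergy_zero_particleHole (hL : Even L) (U θ : ℝ) {δ δ' : ℝ}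
    (hcomp : 2 * ⌊(1 - δ) * (L : ℝ) ^ 2 / 2⌋₊ + 2 * ⌊(1 - δ') * (L : ℝ) ^ 2 / 2⌋₊ = 2 * L ^ 2) :
    fluxEnergy L U δ θ - fluxEnergy L U δ 0 = fluxEnergy L U δ' θ - fluxEnergy L U δ' 0 := by
  have h := fluxEnergyTT'_sub_fluxEnergyTT'_zero_particleHole hL 0 U θ hcomp
  rwa [neg_zero, fluxEnergyTT'_tPrime_zero, fluxEnergyTT'_tPrime_zero, fluxEnergyTT'_tPrime_zero,
    fluxEnergyTT'_tPrime_zero] at h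

/-! ### §3 When are the record sectors complementary? -/

/-- **Complementary record sectors from an integrality witness**: if `n L² = 2m` (`m : ℕ`, `n ≤ 2`), the record
sectors of the dopings `1 - n` and `1 - (2 - n)` (densities `n` and `2 - n`) are complementary:
`2⌊nL²/2⌋ + 2⌊(2-n)L²/2⌋ = 2L²` (the tree's `rectN_two_sub_add_of_eq`, restated on the `fluxEnergyTT'` sector
expressions). [cite: LiebWuPhysicaA2003, §1 eq. (3)] -/
theorem fluxSectors_complementary_of_eq {n : ℝ} (hn2 : n ≤ 2) {L m : ℕ} (h : n * (L : ℝ) ^ 2 = 2 * m) :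
    2 * ⌊(1 - (1 - n)) * (L : ℝ) ^ 2 / 2⌋₊ + 2 * ⌊(1 - (1 - (2 - n))) * (L : ℝ) ^ 2 / 2⌋₊ = 2 * L ^ 2 := by
  have hm : (m : ℝ) ≤ (L : ℝ) ^ 2 := by nlinarith [sq_nonneg (L : ℝ)]
  have hmL : m ≤ L ^ 2 := by exact_mod_cast hm
  have h1 : ⌊(1 - (1 - n)) * (L : ℝ) ^ 2 / 2⌋₊ = m := by
    rw [sub_sub_cancel, h, mul_div_cancel_left₀ _ (two_ne_zero' ℝ), Nat.floor_natCast]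
  have h2 : ⌊(1 - (1 - (2 - n))) * (L : ℝ) ^ 2 / 2⌋₊ = L ^ 2 - m := by
    rw [sub_sub_cancel, show (2 - n) * (L : ℝ) ^ 2 / 2 = (L : ℝ) ^ 2 - m by rw [sub_mul, h]; ring,
      show ((L : ℝ) ^ 2 - m : ℝ) = ((L ^ 2 - m : ℕ) : ℝ) by push_cast [Nat.cast_sub hmL]; ring, Nat.floor_natCast]
  rw [h1, h2]
  omega

end FluxParticleHole

end Literature.MathematicalPhysics.QuantumLattice
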